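import Mathlib.RingTheory.Valuation.ValuationSubring
import Mathlib.RingTheory.Noetherian.Basic
import HarnessLib

/-!
# Route `HomologicalConductor`, crux `NoZenoR` (stmt-ResolutionOfSingularities-19943; aside twin `NoZeno` 16483):
# ZARISKI DESCENT ALONG A NOETHERIAN DOMINATOR — the toolkit for the (NDT-BP) residual of the entry cut

`[OURS · L W4.4]` Cell res-hironaka, crux chain W4.4, CHAIN v21 §3.10 (planner res-L0-w44-plan-1, ruling (ρ35g)): the
valuation-theoretic toolkit that every attacker of the remaining entry-cut piece (NDT-BP) «no divisorial thread with
cofinally many base points» imports.  AUTHORS of the mathematics and of the original Lean texts: res-L0-w44-strat-1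
(line `ndt-zariski` r1 §9: `Zariski.Principalizes`, `Zariski.eventually_not_principalizes`), res-L0-w44-idea-1 (card 11
`valuative-absorption`, Sketch r12: §Absorption below) and res-L0-w44-idea-2 (card 11 `zariski-polar-capture` §10:
`Zariski.Undivided`, `Zariski.not_principalizes_of_undivided`, `Zariski.exists_undivided_pair`; card 12 §10b
`Zariski.stalls_or_catches`); typed into the tree by
res-L0-w44-stub-3 (proofs ported verbatim modulo namespaces; `exhausts_of_absorbing` re-threaded through a subtype of
descent states instead of an auxiliary structure; the hierarchy link `vIdealStepAt_of_principalizes` added).  Nothing here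
is a statement of the manuscript under review (Hironaka 2017); AI-written, weaker than expert review.

THE SETTING.  `V` is a NOETHERIAN valuation ring of a field `K` (in the thread geometry: a prime divisor of `K/k`, a
discrete valuation ring, CASE B of the thread dichotomy `Sandwiched.threadDichotomy`) and `D 0 ≤ D 1 ≤ ⋯ ≤ V` a chain of
subrings DOMINATED by `V` (a `V`-unit of `D n` is a `D n`-unit).  Zariski's classical argument («a prime divisor of the
second kind becomes of the first kind after finitely many quadratic transforms along it», Ann. Math. 40 (1939); Abhyankar,
Ann. Math. 63 (1956), Prop. 3) is a DESCENT of the denominator ideal `b·V` of a fixed fraction `t = a/b ∈ V`: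

* `Zariski.Principalizes D V n` — the step `D n ↪ D (n+1)` principalizes the `V`-non-units of `D n` (the centre of `V` on
  the next model is not a base point); `Zariski.eventually_not_principalizes` — **ZARISKI'S BASE-POINT BUDGET**: if some
  `t = a/b ∈ V` over `D 0` lies in no `D n`, only finitely many steps principalize (Noetherian induction on `b·V`).
* `Zariski.stalls_or_catches` (idea-2 §10b) — a dominated chain whose steps are identities or principalize STALLS or
  CATCHES the fraction.
* `Zariski.Undivided D V a b m` — the pencil `(a, b)` has `(D m :_K (a,b)) ⊆ V`; `Zariski.not_principalizes_of_undivided`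
  (an eventually undivided pencil of `t ∉ ⋃ D n` forbids principalization), `Zariski.exists_undivided_pair` (every
  fraction acquires an eventually undivided representation — the budget in pencil form, domination-free).
* §Absorption (idea-1): `exists_pow_mul_inv_mem` (archimedean property of a Noetherian `V`), `AbsorbedAt` / `Absorbing`
  (the blown-up ideal absorbs a denominator valuatively), `exhausts_of_absorbing` (**ZARISKI DESCENT**: an absorbing
  dominated chain with fraction field `K` exhausts `V`), `not_absorbing_of_witness`, `VIdealStepAt` (the blown-up ideal
  contains the `V`-ideal of its own order), `absorbing_of_vIdealSteps`, `vIdealStepAt_of_centreStep`,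
  `vIdealStepAt_of_principalizes`, `exhausts_of_vIdealSteps`, `no_chain_of_vIdealSteps` (no Noetherian dominator along
  recurring `V`-ideal steps once one element of `V` lies in no member), `exists_multiplier_of_absorbedAt` (absorption ⇒
  idea-2's drop multiplier).

HIERARCHY of the free residual hypotheses on an eternal divisorial thread (idea-1 §n.5): «cofinally no drop multiplier for
the fixed pencil» (idea-2) ⇒ «cofinally not absorbing / no `V`-ideal step» (idea-1) ⇒ «cofinally a base point» (strat-1,
(NDT-BP)).  The ACC lemma `TraceSocle.chain_of_isNoetherianRing` (res-L0-w44-idea-1 / res-L0-w44-stub-1,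
`…NoZenoTraceSocleTerminator`) is imported, not restated.
-/

noncomputable section

-- single-problem summit: the doubled namespace component `ResolutionOfSingularities` is forced
set_option linter.dupNamespace false

namespace Summit.ResolutionOfSingularities.ResolutionOfSingularities.Theorems.NoZeno.ZariskiDescent

variable {K : Type} [Field K]

/-! ## Zariski's base-point budget (res-L0-w44-strat-1, line `ndt-zariski` r1 §9) -/

namespace Zariski

/-- «The step `D n ↪ D (n+1)` PRINCIPALIZES, at `V`, the non-units of `D n`»: ONE element `g` of positive `V`-value
divides inside `D (n+1)` every element of `D n` of positive `V`-value.  For a dominated chain of local rings under a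
valuation ring `V` this says: the ideal `𝔪_{D n}·D_{n+1}` becomes principal (`= g·D_{n+1}`) after localising at `V`'s
centre — i.e. `V`'s centre on the `(n+1)`-st model is NOT a base point of the maximal ideal of the `n`-th (Zariski 1939:
blowing up the centre itself principalizes at every step).  (Author: res-L0-w44-strat-1.) [this work] -/
def Principalizes (D : ℕ → Subring K) (V : ValuationSubring K) (n : ℕ) : Prop :=
  ∃ g : K, V.valuation g < 1 ∧ ∀ x ∈ D n, V.valuation x < 1 → ∃ y ∈ D (n + 1), x = g * y

/-- **ZARISKI'S BASE-POINT BUDGET** (the transferable half of «a prime divisor is uniformised by blowing up its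
centres»).  Let `V` be a NOETHERIAN valuation ring of `K` and `D 0 ≤ D 1 ≤ ⋯ ≤ V` a chain of subrings each DOMINATED
by `V` (an element of `D n` of `V`-value `1` is a unit of `D n`).  If some `t ∈ V` with `t = a / b`, `a, b ∈ D 0`, lies
in NO `D n`, then only finitely many steps principalize: `∃ N, ∀ n ≥ N, ¬ Principalizes D V n`.  PROOF (Zariski's
integer): Noetherian induction on the ideal `b·V`; at a principalizing step `n ≥ m` write `a = g a'`, `b = g b'` in
`D (n+1)` (`a, b` are non-units at `V`: `v(b) = 1` would put `b⁻¹`, hence `t`, in `D n`); then `t = a'/b'` and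
`b'V ⊋ bV` (equality forces `g c = 1` with `v(g) < 1`, `v(c) ≤ 1`).  Model: Zariski, Ann. Math. 40 (1939) 639–689
(finiteness of the quadratic sequence along a prime divisor); Abhyankar, Ann. Math. 63 (1956) 491–526, Prop. 3.
(Author: res-L0-w44-strat-1; proof verbatim.) [this work] -/
theorem eventually_not_principalizes (V : ValuationSubring K) (hV : IsNoetherianRing ↥V) (D : ℕ → Subring K)
    (hmono : ∀ n, D n ≤ D (n + 1)) (hDV : ∀ n, D n ≤ V.toSubring)
    (hdom : ∀ n, ∀ x ∈ D n, V.valuation x = 1 → x⁻¹ ∈ D n)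
    {t : K} (htV : t ∈ V) (ht : ∀ n, t ∉ D n) {a b : K} (ha : a ∈ D 0) (hb : b ∈ D 0) (hb0 : b ≠ 0)
    (htab : t = a / b) :
    ∃ N : ℕ, ∀ n, N ≤ n → ¬ Principalizes D V n := by
  haveI : IsNoetherian ↥V ↥V := hV
  have hmono' : ∀ {m n : ℕ}, m ≤ n → D m ≤ D n := by
    intro m n hmn
    induction hmn with
    | refl => exact le_rfl
    | step _ ih => exact ih.trans (hmono _)
  have htV1 : V.valuation t ≤ 1 := (V.valuation_le_one_iff t).mpr htV
  -- the claim, by Noetherian induction on the denominator ideal `b·V`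
  have key : ∀ (I : Ideal ↥V) (m : ℕ) (a b : K) (hbV : b ∈ V), a ∈ D m → b ∈ D m → b ≠ 0 → t = a / b →
      Ideal.span {(⟨b, hbV⟩ : ↥V)} = I → ∃ N : ℕ, ∀ n, N ≤ n → ¬ Principalizes D V n := by
    intro I
    induction I using IsNoetherian.induction with
    | hgt I ih =>
      intro m a b hbV ha hb hb0 htab hI
      by_cases hex : ∃ n, m ≤ n ∧ Principalizes D V n
      · obtain ⟨n, hmn, g, hg, hdiv⟩ := hex
        have haDn : a ∈ D n := hmono' hmn ha
        have hbDn : b ∈ D n := hmono' hmn hb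
        -- `b` is a non-unit at `V`: otherwise `b⁻¹ ∈ D n` and `t = a * b⁻¹ ∈ D n`
        have hvb : V.valuation b < 1 := by
          rcases V.valuation_lt_one_or_eq_one ⟨b, hbV⟩ with h | h
          · exact h
          · exfalso
            have hbinv : b⁻¹ ∈ D n := hdom n b hbDn h
            apply ht n
            rw [htab, div_eq_mul_inv]
            exact (D n).mul_mem haDn hbinv
        -- hence so is `a = t * b`
        have hatb : a = t * b := by
          rw [htab, div_mul_cancel₀ a hb0]
        have hva : V.valuation a < 1 := by
          calc V.valuation a = V.valuation t * V.valuation b := by rw [hatb, map_mul]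
            _ ≤ 1 * V.valuation b := mul_le_mul' htV1 le_rfl
            _ = V.valuation b := one_mul _
            _ < 1 := hvb
        obtain ⟨a', ha', haeq⟩ := hdiv a haDn hva
        obtain ⟨b', hb', hbeq⟩ := hdiv b hbDn hvb
        have hg0 : g ≠ 0 := by
          rintro rfl
          exact hb0 (by rw [hbeq, zero_mul])
        have hb'0 : b' ≠ 0 := by
          rintro rfl
          exact hb0 (by rw [hbeq, mul_zero])
        have hgV : g ∈ V := (V.valuation_le_one_iff g).mp hg.le
        have hb'V : b' ∈ V := hDV (n + 1) hb'
        have htab' : t = a' / b' := by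
          rw [htab, haeq, hbeq, mul_div_mul_left a' b' hg0]
        -- the denominator ideal grows strictly
        have hle : Ideal.span {(⟨b, hbV⟩ : ↥V)} ≤ Ideal.span {(⟨b', hb'V⟩ : ↥V)} := by
          rw [Ideal.span_singleton_le_span_singleton]
          exact ⟨⟨g, hgV⟩, Subtype.ext (by simp [hbeq, mul_comm])⟩
        have hne : Ideal.span {(⟨b, hbV⟩ : ↥V)} ≠ Ideal.span {(⟨b', hb'V⟩ : ↥V)} := by
          intro heq
          have hdvd : (⟨b, hbV⟩ : ↥V) ∣ ⟨b', hb'V⟩ := by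
            rw [← Ideal.span_singleton_le_span_singleton, heq]
          obtain ⟨c, hc⟩ := hdvd
          have hc' : b' = b * (c : K) := by
            have := congrArg Subtype.val hc
            simpa using this
          have hgc : g * (c : K) = 1 := by
            have h1 : b * (g * (c : K)) = b * 1 := by
              rw [mul_one]
              conv_rhs => rw [hbeq, hc']
              ring
            exact mul_left_cancel₀ hb0 h1
          have hvc : V.valuation (c : K) ≤ 1 := (V.valuation_le_one_iff _).mpr c.2
          have hlt : V.valuation (g * (c : K)) < 1 := by
            calc V.valuation (g * (c : K)) = V.valuation g * V.valuation (c : K) := map_mul _ _ _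
              _ ≤ V.valuation g * 1 := mul_le_mul' le_rfl hvc
              _ = V.valuation g := mul_one _
              _ < 1 := hg
          rw [hgc, map_one] at hlt
          exact lt_irrefl _ hlt
        have hlt : I < Ideal.span {(⟨b', hb'V⟩ : ↥V)} := by
          rw [← hI]
          exact lt_of_le_of_ne hle hne
        exact ih _ hlt (n + 1) a' b' hb'V ha' hb' hb'0 htab' rfl
      · exact ⟨m, fun n hn hP => hex ⟨n, hn, hP⟩⟩
  exact key _ 0 a b (hDV 0 hb) ha hb hb0 htab rfl

/-! ## Undivided pencils (res-L0-w44-idea-2, card 11 `zariski-polar-capture` §10) -/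

/-- «The pencil `(a, b)` is UNDIVIDED in `D m` with respect to `V`»: every `u ∈ K` multiplying BOTH `a` and `b` into
`D m` already lies in `V` — i.e. the fractional ideal `(D m :_K (a, b))` is contained in `V`.  (Author: res-L0-w44-idea-2.)
[this work] -/
def Undivided (D : ℕ → Subring K) (V : ValuationSubring K) (a b : K) (m : ℕ) : Prop :=
  ∀ u : K, u * a ∈ D m → u * b ∈ D m → u ∈ V

/-- An undivided pencil with `b ≠ 0` has NO common factor of positive `V`-value inside `D m`: `a = g a'`, `b = g b'`
with `a', b' ∈ D m` and `v(g) < 1` is impossible (`u := g⁻¹` would lie in `V`).  (Author: res-L0-w44-idea-2.)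
[this work] -/
theorem Undivided.no_common_factor {D : ℕ → Subring K} {V : ValuationSubring K} {a b : K} {m : ℕ}
    (h : Undivided D V a b m) (hb0 : b ≠ 0) {g a' b' : K} (hg : V.valuation g < 1) (ha' : a' ∈ D m)
    (hb' : b' ∈ D m) (haeq : a = g * a') (hbeq : b = g * b') : False := by
  have hg0 : g ≠ 0 := by
    rintro rfl
    exact hb0 (by rw [hbeq, zero_mul])
  have hua : g⁻¹ * a ∈ D m := by
    rw [haeq, ← mul_assoc, inv_mul_cancel₀ hg0, one_mul]
    exact ha'
  have hub : g⁻¹ * b ∈ D m := by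
    rw [hbeq, ← mul_assoc, inv_mul_cancel₀ hg0, one_mul]
    exact hb'
  have hgi : V.valuation g⁻¹ ≤ 1 := (V.valuation_le_one_iff _).mpr (h g⁻¹ hua hub)
  have hlt : V.valuation (1 : K) < 1 := by
    calc V.valuation (1 : K) = V.valuation (g⁻¹ * g) := by rw [inv_mul_cancel₀ hg0]
      _ = V.valuation g⁻¹ * V.valuation g := map_mul _ _ _
      _ ≤ 1 * V.valuation g := mul_le_mul' hgi le_rfl
      _ = V.valuation g := one_mul _
      _ < 1 := hg
  rw [map_one] at hlt
  exact lt_irrefl _ hlt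

/-- **An eventually undivided pencil forbids principalization from that stage on.**  If `t = a/b ∈ V` lies in no
`D n`, `a, b ∈ D n₁`, and `(a, b)` is undivided in `D m` for every `m ≥ n₁`, then NO step `n ≥ n₁` principalizes at
`V`: a principalizing `g` gives `a = g a'`, `b = g b'` in `D (n+1)` (`a, b` have positive `V`-value — `b` because
`b⁻¹ ∈ D n` would put `t` in `D n`), contradicting `Undivided.no_common_factor` at stage `n + 1`.  Hence the pencil
hypothesis of idea-2's (NDT-PC) implies the base-point hypothesis of (NDT-BP) with `N = n₁`.  (Author: res-L0-w44-idea-2.)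
[this work] -/
theorem not_principalizes_of_undivided (V : ValuationSubring K) (D : ℕ → Subring K)
    (hmono : ∀ n, D n ≤ D (n + 1)) (hDV : ∀ n, D n ≤ V.toSubring)
    (hdom : ∀ n, ∀ x ∈ D n, V.valuation x = 1 → x⁻¹ ∈ D n)
    {t : K} (htV : t ∈ V) (ht : ∀ n, t ∉ D n) {a b : K} {n₁ : ℕ} (ha : a ∈ D n₁) (hb : b ∈ D n₁)
    (hb0 : b ≠ 0) (htab : t = a / b) (hund : ∀ m, n₁ ≤ m → Undivided D V a b m) :
    ∀ n, n₁ ≤ n → ¬ Principalizes D V n := by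
  have hmono' : ∀ {m n : ℕ}, m ≤ n → D m ≤ D n := by
    intro m n hmn
    induction hmn with
    | refl => exact le_rfl
    | step _ ih => exact ih.trans (hmono _)
  have htV1 : V.valuation t ≤ 1 := (V.valuation_le_one_iff t).mpr htV
  rintro n hn ⟨g, hg, hdiv⟩
  have haDn : a ∈ D n := hmono' hn ha
  have hbDn : b ∈ D n := hmono' hn hb
  -- `b` is a non-unit at `V`: otherwise `b⁻¹ ∈ D n` and `t = a * b⁻¹ ∈ D n`
  have hvb : V.valuation b < 1 := by
    rcases V.valuation_lt_one_or_eq_one ⟨b, hDV n hbDn⟩ with h | h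
    · exact h
    · exfalso
      have hbinv : b⁻¹ ∈ D n := hdom n b hbDn h
      apply ht n
      rw [htab, div_eq_mul_inv]
      exact (D n).mul_mem haDn hbinv
  -- hence so is `a = t * b`
  have hatb : a = t * b := by
    rw [htab, div_mul_cancel₀ a hb0]
  have hva : V.valuation a < 1 := by
    calc V.valuation a = V.valuation t * V.valuation b := by rw [hatb, map_mul]
      _ ≤ 1 * V.valuation b := mul_le_mul' htV1 le_rfl
      _ = V.valuation b := one_mul _
      _ < 1 := hvb
  obtain ⟨a', ha', haeq⟩ := hdiv a haDn hva
  obtain ⟨b', hb', hbeq⟩ := hdiv b hbDn hvb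
  exact (hund (n + 1) (hn.trans (Nat.le_succ n))).no_common_factor hb0 hg ha' hb' haeq hbeq

/-- **ZARISKI'S BUDGET IN PENCIL FORM: every fraction over the chain acquires an eventually UNDIVIDED representation.**
`V` Noetherian, `D n ≤ V` for all `n`; if `t = a/b` with `a, b ∈ D n₀`, `b ≠ 0`, then for some `n₁ ≥ n₀` and
`a', b' ∈ D n₁` with `t = a'/b'`, the pencil `(a', b')` is undivided in `D m` for EVERY `m ≥ n₁`.  PROOF: Noetherian
induction on the denominator ideal `b·V`: a divided stage `m ≥ n₀` (some `u ∉ V` with `u a, u b ∈ D m`) replaces `(a, b)`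
by `(u a, u b)` and `b·V` by the STRICTLY larger `(u b)·V` (`b = u⁻¹·(u b)`, `u⁻¹ ∈ V`; equality would force `u ∈ V`).
No domination and no `t ∉ D n` is used.  (Author: res-L0-w44-idea-2.) [this work] -/
theorem exists_undivided_pair (V : ValuationSubring K) (hV : IsNoetherianRing ↥V) (D : ℕ → Subring K)
    (hDV : ∀ n, D n ≤ V.toSubring) {t a b : K} {n₀ : ℕ} (ha : a ∈ D n₀) (hb : b ∈ D n₀) (hb0 : b ≠ 0)
    (htab : t = a / b) :
    ∃ (n₁ : ℕ) (a' b' : K), n₀ ≤ n₁ ∧ a' ∈ D n₁ ∧ b' ∈ D n₁ ∧ b' ≠ 0 ∧ t = a' / b' ∧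
      ∀ m, n₁ ≤ m → Undivided D V a' b' m := by
  haveI : IsNoetherian ↥V ↥V := hV
  have key : ∀ (I : Ideal ↥V) (m : ℕ) (a b : K) (hbV : b ∈ V), a ∈ D m → b ∈ D m → b ≠ 0 → t = a / b →
      Ideal.span {(⟨b, hbV⟩ : ↥V)} = I →
      ∃ (n₁ : ℕ) (a' b' : K), m ≤ n₁ ∧ a' ∈ D n₁ ∧ b' ∈ D n₁ ∧ b' ≠ 0 ∧ t = a' / b' ∧
        ∀ m', n₁ ≤ m' → Undivided D V a' b' m' := by
    intro I
    induction I using IsNoetherian.induction with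
    | hgt I ih =>
      intro m a b hbV ha hb hb0 htab hI
      by_cases hex : ∃ m', m ≤ m' ∧ ∃ u : K, u * a ∈ D m' ∧ u * b ∈ D m' ∧ u ∉ V
      · obtain ⟨m', hmm', u, hua, hub, huV⟩ := hex
        have hu0 : u ≠ 0 := by
          rintro rfl
          exact huV V.zero_mem
        have huinv : u⁻¹ ∈ V := (V.mem_or_inv_mem u).resolve_left huV
        have hub0 : u * b ≠ 0 := mul_ne_zero hu0 hb0
        have hubV : u * b ∈ V := hDV m' hub
        have htab' : t = (u * a) / (u * b) := by
          rw [htab, mul_div_mul_left a b hu0]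
        -- the denominator ideal grows …
        have hle : Ideal.span {(⟨b, hbV⟩ : ↥V)} ≤ Ideal.span {(⟨u * b, hubV⟩ : ↥V)} := by
          rw [Ideal.span_singleton_le_span_singleton]
          refine ⟨⟨u⁻¹, huinv⟩, Subtype.ext ?_⟩
          change b = u * b * u⁻¹
          rw [mul_assoc, mul_comm b u⁻¹, ← mul_assoc, mul_inv_cancel₀ hu0, one_mul]
        -- … strictly
        have hne : Ideal.span {(⟨b, hbV⟩ : ↥V)} ≠ Ideal.span {(⟨u * b, hubV⟩ : ↥V)} := by
          intro heq
          have hdvd : (⟨b, hbV⟩ : ↥V) ∣ ⟨u * b, hubV⟩ := by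
            rw [← Ideal.span_singleton_le_span_singleton, heq]
          obtain ⟨c, hc⟩ := hdvd
          have hc' : u * b = b * (c : K) := by
            have := congrArg Subtype.val hc
            simpa using this
          have huc : u = (c : K) := by
            have h1 : u * b = (c : K) * b := by rw [hc', mul_comm]
            exact mul_right_cancel₀ hb0 h1
          apply huV
          rw [huc]
          exact c.2
        have hlt : I < Ideal.span {(⟨u * b, hubV⟩ : ↥V)} := by
          rw [← hI]
          exact lt_of_le_of_ne hle hne
        obtain ⟨n₁, a', b', hn₁, hrest⟩ := ih _ hlt m' (u * a) (u * b) hubV hua hub hub0 htab' rfl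
        exact ⟨n₁, a', b', hmm'.trans hn₁, hrest⟩
      · refine ⟨m, a, b, le_rfl, ha, hb, hb0, htab, fun m' hm' u hua hub => ?_⟩
        by_contra huV
        exact hex ⟨m', hm', u, hua, hub, huV⟩
  exact key _ n₀ a b (hDV n₀ hb) ha hb hb0 htab rfl

/-! ## Settling (res-L0-w44-idea-2, card 12 `essential-divisor-extraction` §10b) -/

/-- **SETTLING.**  A chain `R 0 ≤ R 1 ≤ ⋯ ≤ V` dominated by the Noetherian valuation ring `V`, in which every step is the
identity or principalizes at `V` (e.g. the local rings, at the centres of `V`, of successive quadratic transforms along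
`V`), either STALLS (`R n = R N` for all `n ≥ N`) or CATCHES the fraction `t = a/b ∈ V` (`a, b ∈ R 0`): `t ∈ R n` for some
`n`.  Corollary of `eventually_not_principalizes`.  (Author: res-L0-w44-idea-2.) [this work] -/
theorem stalls_or_catches (V : ValuationSubring K) (hV : IsNoetherianRing ↥V) (R : ℕ → Subring K)
    (hmono : ∀ n, R n ≤ R (n + 1)) (hRV : ∀ n, R n ≤ V.toSubring)
    (hdom : ∀ n, ∀ x ∈ R n, V.valuation x = 1 → x⁻¹ ∈ R n)
    (hstep : ∀ n, R (n + 1) = R n ∨ Principalizes R V n)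
    {t : K} (htV : t ∈ V) {a b : K} (ha : a ∈ R 0) (hb : b ∈ R 0) (hb0 : b ≠ 0) (htab : t = a / b) :
    (∃ N : ℕ, ∀ n, N ≤ n → R n = R N) ∨ (∃ n : ℕ, t ∈ R n) := by
  by_cases ht : ∃ n : ℕ, t ∈ R n
  · exact Or.inr ht
  · left
    push Not at ht
    obtain ⟨N, hN⟩ := eventually_not_principalizes V hV R hmono hRV hdom htV ht ha hb hb0 htab
    refine ⟨N, fun n hn => ?_⟩
    induction hn with
    | refl => rfl
    | step hle ih =>
      rcases hstep _ with h | h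
      · rw [h, ih]
      · exact absurd h (hN _ hle)

end Zariski

end Summit.ResolutionOfSingularities.ResolutionOfSingularities.Theorems.NoZeno.ZariskiDescent

end
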